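import Summits.CriticalPhenomena.PercolationContinuityZ3.Theorems.PercNearOneGluingNoHeavyLowerTailOneLayerQ7
import Summits.CriticalPhenomena.PercolationContinuityZ3.Theorems.PercNearOneGluingNoHeavyLowerTailKNGoodHairTools
import Summits.CriticalPhenomena.PercolationContinuityZ3.Theorems.PercNearOneGluingAdditiveGluingOneBond
import Summits.CriticalPhenomena.PercolationContinuityZ3.Theorems.PercNearOneGluingNoHeavyLowerTailTwoPortPeelingSurePairs
import HarnessLib

/-!
# `NoHeavyLowerTail` (stmt-CriticalPhenomena-4575) — Kozma–Nitzan's Question 9 for a ONE-LAYER observer,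
# with the comparison relay ranked in the graph with ONE HAIR LOWERED

Support file (lead seat `prim-nh-lead-4575` gen 9; `--supports stmt-CriticalPhenomena-4575`).
No definitions, no named facts, no sorries.

Kozma–Nitzan (arXiv:2401.12397) Theorem 4 ranks the comparison relay of a one-layer observer `0` in `G ∖ {0}`
(ALL hairs of `0` removed); `OneLayerQ7.oneLayer_preFKG_of_dominated_inG` ranks it in `G` itself (NO hair
removed).  This file interpolates along ONE hair: the relay may be ranked in the graph `G'` obtained from `G` by
LOWERING the weight of a single pair `s(0,p)` (to any value, e.g. `0`).

* `OneLayerHairLowering.oneLayer_preFKG_of_dominated_lowerHair` — if `a ≠ 0` is at most as connected to `b`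
  in `G' = G[s(0,p) ↦ t]`, `t ≤ w s(0,p)`, as `p` and as every port of `0` in `G'`, then the pre-FKG inequality
  (41) holds at `a` in `G`: `P_G(a ↔ b, 0 ↔ A) ≤ P_G(0 ↔ b, 0 ↔ A)`.
  Proof: the (41)-margin is affine in the weight of `s(0,p)` (one-bond decomposition); at the value `t` it is
  nonnegative by `oneLayer_preFKG_of_dominated_inG` applied to `G'`; at the value `1` the pair `s(0,p)` is a.s.
  open, `0 ↔ A` is a.s. sure, and `P(a ↔ b) ≤ P(0 ↔ b)` is the in-graph gluing transfer
  (`KNGoodHair.glueTransfer_openConn`: glue `0` into the winner `p`); affinity on `[t, 1] ∋ w s(0,p)` concludes.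

Role in the cell (lead memo LEAD-GEN9.md §2d, KERNEL-BETA-R-TORUS.md): this is exactly the "single-port child"
case of the depth-two two-lonely-children kernel — after hp-1's piece decomposition the glued piece is a one-layer
block `ȳ` = the star `y` with its hair to `p` RAISED, while the Question-9 relay is ranked in the split graph
`G − 0 = K + y` = the block with that hair LOWERED back.
-/

namespace Summit.CriticalPhenomena.PercolationContinuityZ3.Theorems

open MeasureTheory Set
open Literature.Probability.LatticeModels (prodBernoulli)
open Literature.Probability.Percolation

noncomputable section
open Classical

namespace OneLayerHairLowering

variable {n : ℕ}

/-- Real arithmetic: an affine function `f(u) = (1−u) f₀ + u f₁` with `f(t) ≥ 0` and `f₁ ≥ 0` is `≥ 0` on `[t,1]`.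
[folklore] -/
theorem affine_nonneg_on_tail {f₀ f₁ t s : ℝ} (ht : 0 ≤ t) (hts : t ≤ s) (hs : s ≤ 1)
    (hft : 0 ≤ (1 - t) * f₀ + t * f₁) (hf₁ : 0 ≤ f₁) : 0 ≤ (1 - s) * f₀ + s * f₁ := by
  by_cases h : 0 ≤ f₀
  · have h2 : 0 ≤ (1 - s) * f₀ := mul_nonneg (by linarith) h
    have h3 : 0 ≤ s * f₁ := mul_nonneg (by linarith) hf₁
    linarith
  · push Not at h
    have h1 : (1 - s) * f₀ ≥ (1 - t) * f₀ := by nlinarith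
    have h2 : s * f₁ ≥ t * f₁ := by nlinarith
    linarith

/-- **Kozma–Nitzan's Question 9 for a one-layer observer, one hair lowered (witness form).**  Let `0 ∉ A` be
isolated in `G ∖ A`, `p ∈ A`, and let `G' := G[s(0,p) ↦ t]` with `t ≤ w s(0,p)`.  If `a ≠ 0` satisfies
`P_{G'}(a ↔ b) ≤ P_{G'}(p ↔ b)` and `P_{G'}(a ↔ b) ≤ P_{G'}(q ↔ b)` for every `q ∈ A` with `G'`-weight
`s(0,q) ≠ 0`, then the pre-FKG inequality (41) holds at `a` in `G`:
`P_G(a ↔ b, 0 ↔ A) ≤ P_G(0 ↔ b, 0 ↔ A)`.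
(`t = w s(0,p)`: `OneLayerQ7.oneLayer_preFKG_of_dominated_inG`; `t = 0` and `p` the only port: the depth-two
"single-port child" of the two-lonely-children kernel.) [cite: KozmaNitzan2024, Thm. 4 (pp. 12–14), Question 9 (p. 36)] -/
theorem oneLayer_preFKG_of_dominated_lowerHair (w : Sym2 (Fin n) → unitInterval) (A : Finset (Fin n))
    (o b a p : Fin n) (hoA : o ∉ A) (hao : a ≠ o) (hpA : p ∈ A)
    (hiso : ∀ u, u ≠ o → u ∉ A → w s(o, u) = 0)
    (t : unitInterval) (ht : t ≤ w s(o, p))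
    (hdomp : (prodBernoulli (Function.update w s(o, p) t)).real (openConn a b) ≤
      (prodBernoulli (Function.update w s(o, p) t)).real (openConn p b))
    (hdom : ∀ q ∈ A, (Function.update w s(o, p) t) s(o, q) ≠ 0 →
      (prodBernoulli (Function.update w s(o, p) t)).real (openConn a b) ≤
        (prodBernoulli (Function.update w s(o, p) t)).real (openConn q b)) :
    (prodBernoulli w).real (openConn a b ∩ ⋃ a' ∈ A, openConn o a') ≤
      (prodBernoulli w).real (openConn o b ∩ ⋃ a' ∈ A, openConn o a') := by
  classical
  haveI : ∀ u : Sym2 (Fin n) → unitInterval, IsProbabilityMeasure (prodBernoulli u) := fun u => inferInstance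
  have hpo : p ≠ o := fun h => hoA (h ▸ hpA)
  set e : Sym2 (Fin n) := s(o, p) with he
  set U : Set (BondConfig (Fin n)) := ⋃ a' ∈ A, openConn o a' with hU
  set S₁ : Set (BondConfig (Fin n)) := openConn a b ∩ U with hS₁
  set S₂ : Set (BondConfig (Fin n)) := openConn o b ∩ U with hS₂
  set w' := Function.update w e t with hw'
  set w₀ := Function.update w e 0 with hw₀
  set w₁ := Function.update w e 1 with hw₁
  -- the margin f(u) := P_{w[e↦u]}(S₂) − P_{w[e↦u]}(S₁) is affine in u
  have hdec : ∀ (u : unitInterval) (S : Set (BondConfig (Fin n))),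
      (prodBernoulli (Function.update w e u)).real S =
        (1 - (u : ℝ)) * (prodBernoulli w₀).real S + (u : ℝ) * (prodBernoulli w₁).real S := by
    intro u S
    have h := stub_oneBondDecomp_k15 n (Function.update w e u) e S
    simp only [Function.update_self, Function.update_idem] at h
    rw [hw₀, hw₁]; exact h
  -- value at u = t : nonnegative by the one-layer theorem applied to G' = w'
  have hiso' : ∀ u, u ≠ o → u ∉ A → w' s(o, u) = 0 := by
    intro u huo huA
    have hne : s(o, u) ≠ e := by
      rw [he]; intro hh
      have : u = p := by
        rcases Sym2.eq_iff.1 hh with ⟨_, h2⟩ | ⟨h1, h2⟩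
        · exact h2
        · exact (huo h2).elim
      exact huA (this ▸ hpA)
    rw [hw', Function.update_of_ne hne]; exact hiso u huo huA
  have ht_ineq : (prodBernoulli w').real S₁ ≤ (prodBernoulli w').real S₂ :=
    oneLayer_preFKG_of_dominated_inG w' A o b a hoA hao hiso' hdom
  -- value at u = 1 : gluing transfer + `e` a.s. open
  have h1_le : (prodBernoulli w₁).real S₁ ≤ (prodBernoulli w₁).real S₂ := by
    have hglue : (prodBernoulli (Function.update w' e 1)).real (openConn a b) ≤
        (prodBernoulli (Function.update w' e 1)).real (openConn o b) :=
      KNGoodHair.glueTransfer_openConn w' o p a b (Ne.symm hpo) hdomp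
    have hw1' : Function.update w' e 1 = w₁ := by rw [hw', hw₁, Function.update_idem]
    rw [hw1'] at hglue
    -- P(S₁) ≤ P(a ↔ b)
    have hS1 : (prodBernoulli w₁).real S₁ ≤ (prodBernoulli w₁).real (openConn a b) :=
      measureReal_mono inter_subset_left
    -- P(0 ↔ b) ≤ P(S₂) + P(e closed) = P(S₂)
    have hnull : (prodBernoulli w₁).real {ω : BondConfig (Fin n) | e ∉ ω} = 0 :=
      TwoPortPeeling.real_notMem_eq_zero_of_one w₁ e (by rw [hw₁, Function.update_self])
    have hsub : (openConn o b : Set (BondConfig (Fin n))) ⊆ S₂ ∪ {ω | e ∉ ω} := by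
      intro ω hω
      by_cases hmem : e ∈ ω
      · left
        refine ⟨hω, ?_⟩
        have hadj : (openGraph ω).Adj o p := (openGraph_adj ω o p).2 ⟨hmem, hpo.symm⟩
        exact mem_iUnion₂.2 ⟨p, hpA, hadj.reachable⟩
      · right; exact hmem
    have hS2 : (prodBernoulli w₁).real (openConn o b) ≤ (prodBernoulli w₁).real S₂ := by
      calc (prodBernoulli w₁).real (openConn o b)
          ≤ (prodBernoulli w₁).real (S₂ ∪ {ω | e ∉ ω}) := measureReal_mono hsub
        _ ≤ (prodBernoulli w₁).real S₂ + (prodBernoulli w₁).real {ω | e ∉ ω} := measureReal_union_le _ _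
        _ = (prodBernoulli w₁).real S₂ := by rw [hnull, add_zero]
    linarith
  -- affinity: f(t) ≥ 0, f(1) ≥ 0, t ≤ w e ≤ 1 ⟹ f(w e) ≥ 0
  have hwt : (prodBernoulli w').real S₁ = (1 - (t : ℝ)) * (prodBernoulli w₀).real S₁ + (t : ℝ) * (prodBernoulli w₁).real S₁ := hdec t S₁
  have hwt2 : (prodBernoulli w').real S₂ = (1 - (t : ℝ)) * (prodBernoulli w₀).real S₂ + (t : ℝ) * (prodBernoulli w₁).real S₂ := hdec t S₂
  have hwe : Function.update w e (w e) = w := Function.update_eq_self e w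
  have hw_1 : (prodBernoulli w).real S₁ = (1 - (w e : ℝ)) * (prodBernoulli w₀).real S₁ + (w e : ℝ) * (prodBernoulli w₁).real S₁ := by
    have := hdec (w e) S₁; rwa [hwe] at this
  have hw_2 : (prodBernoulli w).real S₂ = (1 - (w e : ℝ)) * (prodBernoulli w₀).real S₂ + (w e : ℝ) * (prodBernoulli w₁).real S₂ := by
    have := hdec (w e) S₂; rwa [hwe] at this
  have key := affine_nonneg_on_tail (f₀ := (prodBernoulli w₀).real S₂ - (prodBernoulli w₀).real S₁)
    (f₁ := (prodBernoulli w₁).real S₂ - (prodBernoulli w₁).real S₁) (t := (t : ℝ)) (s := (w e : ℝ))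
    (unitInterval.nonneg t) (by rw [he]; exact_mod_cast ht) (unitInterval.le_one (w e)) (by nlinarith [ht_ineq, hwt, hwt2]) (by linarith)
  nlinarith [key, hw_1, hw_2]

end OneLayerHairLowering

end

end Summit.CriticalPhenomena.PercolationContinuityZ3.Theorems
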